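import Mathlib
import Summits.ABC.ABC.Theses.CongruentialReceptacle
import Summits.ABC.ABC.Theorems.CongruentialReceptacleTameLocalReceptacleDefs
import Literature.Barriers.ABC.BakerMethodBoundsThreeRoutesProofs

/-!
# Crux `TameLocalReceptacle` (stmt-ABC-14354): lemmas for the window-tightness certificate

Elementary bookkeeping used by `TameLocalReceptacleWindowSixTight.lean` (crux disprover
`refuter-cdisprove-stmt-ABC-14354-0`): the witness exponents (`exists_balanced_pow`: for every `J`
one of `J, J+1` has `3^J'/2^K ∈ [10/9, 2)`), the summed lower window (`recSum_lower`), the crude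
a-priori bound from the upper window (`abs_recSum_le`) and `Σ_{p ∣ 2^K b 3^J} log p ≤ log 2 + log 3 + log b`
(`sum_log_primeFactors_le`).  No statement of the route is asserted here.
-/

-- `Summit.<Summit>.<Problem>` is the mandated summit-side namespace (CONVENTIONS §2); for the
-- single-conjunct summit `ABC` the two coincide, so the duplicate `ABC.ABC` is deliberate.
set_option linter.dupNamespace false

namespace Summit.ABC.ABC.Theorems.TameLocalReceptacle

open Finset Literature.NumberTheory.DiophantineGeometry
open Summit.ABC.ABC.Theses.CongruentialReceptacle

/-! ### The witness triples `(2^K, 3^J − 2^K, 3^J)` -/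

/-- For every `J ≥ 1` one of `J, J + 1` gives a ratio `3^J'/2^K ∈ [10/9, 2)`. [folklore] -/
theorem exists_balanced_pow (J : ℕ) :
    ∃ J' K : ℕ, J ≤ J' ∧ J' ≤ J + 1 ∧ 2 ^ K ≤ 3 ^ J' ∧ 3 ^ J' < 2 ^ (K + 1) ∧
      10 * 2 ^ K ≤ 9 * 3 ^ J' := by
  set K := Nat.log 2 (3 ^ J) with hK
  have h1 : 2 ^ K ≤ 3 ^ J := Nat.pow_log_le_self 2 (by positivity)
  have h2 : 3 ^ J < 2 ^ (K + 1) := Nat.lt_pow_succ_log_self (by norm_num) _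
  by_cases h : 10 * 2 ^ K ≤ 9 * 3 ^ J
  · exact ⟨J, K, le_rfl, by omega, h1, h2, h⟩
  · replace h := Nat.lt_of_not_le h
    refine ⟨J + 1, K + 1, by omega, le_rfl, ?_, ?_, ?_⟩
    · rw [pow_succ, pow_succ]; omega
    · rw [pow_succ 3, pow_succ 2 (K + 1), pow_succ 2 K]; omega
    · rw [pow_succ, pow_succ]; omega

/-! ### Window bookkeeping -/

/-- **Lower window, summed.** For a table in the lower window with constant `C` (and `c₁ ≥ 0`),
`recSum t a b c ≥ c₁ (2 log(abc) − (C + ε) Σ_{p ∣ abc} log p)`. [folklore] -/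
theorem recSum_lower {C ε c₁ : ℝ} {t : Table}
    (hw : ∀ p i j k r s z : ℕ, p.Prime →
      c₁ * (2 * ((i + j + k : ℕ) : ℝ) - C - ε) * Real.log p ≤ (t p i j k r s z : ℝ))
    {a b c : ℕ} (ha : a ≠ 0) (hb : b ≠ 0) (hc : c ≠ 0) :
    c₁ * (2 * Real.log ((a * b * c : ℕ) : ℝ) - (C + ε) * ∑ p ∈ (a * b * c).primeFactors, Real.log p)
      ≤ (recSum t a b c : ℝ) := by
  have habc : a * b * c ≠ 0 := by positivity
  have hfac : ∀ p, ((a * b * c).factorization p : ℝ) =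
      ((a.factorization p + b.factorization p + c.factorization p : ℕ) : ℝ) := by
    intro p
    rw [Nat.factorization_mul (by positivity) hc, Nat.factorization_mul ha hb]
    simp
  have hcast : (recSum t a b c : ℝ) = ∑ p ∈ (a * b * c).primeFactors,
      (t p (a.factorization p) (b.factorization p) (c.factorization p) (a / p ^ a.factorization p % p)
        (b / p ^ b.factorization p % p) (c / p ^ c.factorization p % p) : ℝ) := by
    unfold recSum; push_cast; rfl
  have hlhs : c₁ * (2 * Real.log ((a * b * c : ℕ) : ℝ) -
      (C + ε) * ∑ p ∈ (a * b * c).primeFactors, Real.log p)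
      = ∑ p ∈ (a * b * c).primeFactors,
          c₁ * (2 * ((a.factorization p + b.factorization p + c.factorization p : ℕ) : ℝ) - C - ε) *
            Real.log p := by
    rw [Literature.Barriers.ABC.log_eq_sum_factorization_mul_log habc, Finset.mul_sum, Finset.mul_sum, ← Finset.sum_sub_distrib,
      Finset.mul_sum]
    refine Finset.sum_congr rfl fun p _ => ?_
    rw [hfac p]; ring
  rw [hcast, hlhs]
  refine Finset.sum_le_sum fun p hp => ?_
  exact hw p _ _ _ _ _ _ (Nat.prime_of_mem_primeFactors hp)

/-- The upper window bounds the receptacle sum a priori (crudely) in terms of the height. [folklore] -/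
theorem abs_recSum_le {c₁' : ℝ} {t : Table}
    (hhi : ∀ p i j k r s z : ℕ, p.Prime →
      |(t p i j k r s z : ℝ)| ≤ c₁' * (((i + j + k : ℕ) : ℝ) + 1) * Real.log p)
    (hc : 0 ≤ c₁') {a b c N : ℕ} (ha : 0 < a) (hb : 0 < b) (hc0 : 0 < c) (haN : a ≤ N) (hbN : b ≤ N)
    (hcN : c ≤ N) :
    |(recSum t a b c : ℝ)| ≤ c₁' * ((3 * N + 1 : ℕ) : ℝ) * ((N ^ 3 : ℕ) : ℝ) * ((N ^ 3 + 1 : ℕ) : ℝ) := by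
  unfold recSum
  push_cast [Int.cast_sum]
  have habcN : a * b * c ≤ N ^ 3 := by
    calc a * b * c ≤ N * N * N := by gcongr
      _ = N ^ 3 := by ring
  have hterm : ∀ p ∈ (a * b * c).primeFactors,
      |(t p (a.factorization p) (b.factorization p) (c.factorization p) (a / p ^ a.factorization p % p)
        (b / p ^ b.factorization p % p) (c / p ^ c.factorization p % p) : ℝ)|
        ≤ c₁' * ((3 * N + 1 : ℕ) : ℝ) * ((N ^ 3 : ℕ) : ℝ) := by
    intro p hp
    have hpp : p.Prime := Nat.prime_of_mem_primeFactors hp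
    have hpabc : p ≤ a * b * c := Nat.le_of_mem_primeFactors hp
    have hw := hhi p (a.factorization p) (b.factorization p) (c.factorization p)
      (a / p ^ a.factorization p % p) (b / p ^ b.factorization p % p) (c / p ^ c.factorization p % p) hpp
    have hK : a.factorization p + b.factorization p + c.factorization p ≤ 3 * N := by
      have h1 := Nat.factorization_lt p ha.ne'
      have h2 := Nat.factorization_lt p hb.ne'
      have h3 := Nat.factorization_lt p hc0.ne'
      omega
    have hK' : (((a.factorization p + b.factorization p + c.factorization p : ℕ) : ℝ) + 1)
        ≤ ((3 * N + 1 : ℕ) : ℝ) := by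
      push_cast
      exact_mod_cast (by omega : a.factorization p + b.factorization p + c.factorization p + 1 ≤ 3 * N + 1)
    have hp0 : (0 : ℝ) < p := by exact_mod_cast hpp.pos
    have hlogp : Real.log p ≤ ((N ^ 3 : ℕ) : ℝ) := by
      have h1 : Real.log p ≤ (p : ℝ) - 1 := Real.log_le_sub_one_of_pos hp0
      have h2 : (p : ℝ) ≤ ((N ^ 3 : ℕ) : ℝ) := by exact_mod_cast hpabc.trans habcN
      linarith
    have hlog0 : 0 ≤ Real.log p := Real.log_nonneg (by exact_mod_cast hpp.one_le)
    calc _ ≤ c₁' * (((a.factorization p + b.factorization p + c.factorization p : ℕ) : ℝ) + 1) *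
          Real.log p := hw
      _ ≤ c₁' * ((3 * N + 1 : ℕ) : ℝ) * Real.log p := by gcongr
      _ ≤ c₁' * ((3 * N + 1 : ℕ) : ℝ) * ((N ^ 3 : ℕ) : ℝ) := by gcongr
  have hcard : ((a * b * c).primeFactors.card : ℝ) ≤ ((N ^ 3 + 1 : ℕ) : ℝ) := by
    have h1 : (a * b * c).primeFactors ⊆ Finset.range (a * b * c + 1) := by
      intro p hp
      exact Finset.mem_range.mpr (Nat.lt_succ_of_le (Nat.le_of_mem_primeFactors hp))
    have h2 := Finset.card_le_card h1
    rw [Finset.card_range] at h2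
    exact_mod_cast h2.trans (by omega)
  calc |∑ p ∈ (a * b * c).primeFactors, (t p (a.factorization p) (b.factorization p) (c.factorization p)
          (a / p ^ a.factorization p % p) (b / p ^ b.factorization p % p) (c / p ^ c.factorization p % p) : ℝ)|
      ≤ ∑ p ∈ (a * b * c).primeFactors, |(t p (a.factorization p) (b.factorization p) (c.factorization p)
          (a / p ^ a.factorization p % p) (b / p ^ b.factorization p % p) (c / p ^ c.factorization p % p) : ℝ)| :=
        Finset.abs_sum_le_sum_abs _ _
    _ ≤ ∑ _p ∈ (a * b * c).primeFactors, c₁' * ((3 * N + 1 : ℕ) : ℝ) * ((N ^ 3 : ℕ) : ℝ) :=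
        Finset.sum_le_sum hterm
    _ = ((a * b * c).primeFactors.card : ℝ) * (c₁' * ((3 * N + 1 : ℕ) : ℝ) * ((N ^ 3 : ℕ) : ℝ)) := by
        rw [Finset.sum_const, nsmul_eq_mul]
    _ ≤ ((N ^ 3 + 1 : ℕ) : ℝ) * (c₁' * ((3 * N + 1 : ℕ) : ℝ) * ((N ^ 3 : ℕ) : ℝ)) := by
        gcongr
    _ = _ := by push_cast; ring

/-- Sum of a nonnegative function over `insert a s` is at most `f a` plus the sum over `s`. [folklore] -/
theorem sum_insert_le_of_nonneg {s : Finset ℕ} {f : ℕ → ℝ} (a : ℕ) (h : ∀ x, 0 ≤ f x) :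
    ∑ x ∈ insert a s, f x ≤ f a + ∑ x ∈ s, f x := by
  by_cases ha : a ∈ s
  · rw [Finset.insert_eq_of_mem ha]; linarith [h a]
  · rw [Finset.sum_insert ha]

/-- The primes of `2^K · b · 3^J` have `Σ log p ≤ log 2 + log 3 + log b` (`b > 0`). [folklore] -/
theorem sum_log_primeFactors_le (K J : ℕ) {b : ℕ} (hb : 0 < b) :
    ∑ p ∈ (2 ^ K * b * 3 ^ J).primeFactors, Real.log p ≤ Real.log 2 + Real.log 3 + Real.log b := by
  have hsub : (2 ^ K * b * 3 ^ J).primeFactors ⊆ insert 2 (insert 3 b.primeFactors) := by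
    intro p hp
    have hpp := Nat.prime_of_mem_primeFactors hp
    have hdvd := Nat.dvd_of_mem_primeFactors hp
    simp only [Finset.mem_insert]
    rcases (Nat.Prime.dvd_mul hpp).mp hdvd with h | h
    · rcases (Nat.Prime.dvd_mul hpp).mp h with h' | h'
      · left; exact (Nat.prime_dvd_prime_iff_eq hpp Nat.prime_two).mp (hpp.dvd_of_dvd_pow h')
      · right; right; exact Nat.mem_primeFactors.mpr ⟨hpp, h', hb.ne'⟩
    · right; left; exact (Nat.prime_dvd_prime_iff_eq hpp Nat.prime_three).mp (hpp.dvd_of_dvd_pow h)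
  have hnn : ∀ p : ℕ, 0 ≤ Real.log p := fun p => Real.log_natCast_nonneg p
  have hf : ∀ p ∈ b.primeFactors, ((p : ℕ) : ℝ) ≠ 0 := fun p hp => by
    exact_mod_cast (Nat.prime_of_mem_primeFactors hp).ne_zero
  have hrad : ∑ p ∈ b.primeFactors, Real.log p ≤ Real.log b := by
    rw [← Real.log_prod hf]
    apply Real.log_le_log
    · exact Finset.prod_pos fun p hp => by exact_mod_cast (Nat.prime_of_mem_primeFactors hp).pos
    · have h1 : (∏ p ∈ b.primeFactors, p) ≤ b := Nat.le_of_dvd hb (Nat.prod_primeFactors_dvd b)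
      have h2 : ((∏ p ∈ b.primeFactors, p : ℕ) : ℝ) ≤ (b : ℝ) := by exact_mod_cast h1
      push_cast at h2
      exact h2
  calc ∑ p ∈ (2 ^ K * b * 3 ^ J).primeFactors, Real.log p
      ≤ ∑ p ∈ insert 2 (insert 3 b.primeFactors), Real.log p :=
        Finset.sum_le_sum_of_subset_of_nonneg hsub fun p _ _ => hnn p
    _ ≤ Real.log (2 : ℕ) + (Real.log (3 : ℕ) + ∑ p ∈ b.primeFactors, Real.log p) := by
        refine (sum_insert_le_of_nonneg 2 hnn).trans ?_
        have h3 := sum_insert_le_of_nonneg (s := b.primeFactors) (f := fun p : ℕ => Real.log p) 3 hnn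
        linarith
    _ ≤ Real.log 2 + Real.log 3 + Real.log b := by
        push_cast
        linarith

end Summit.ABC.ABC.Theorems.TameLocalReceptacle
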